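import Summits.MatrixMultiplication.MatrixMultiplication.Theses.DefinableSTPPDichotomy

/-!
# Sketch (crux-ideate k=2, stmt-MatrixMultiplication-17883): Chebotarev recurrence along
translated block curves — the combinatorial core (PROVED) and the named-fact shape of the
recurrence principle `DefinableTranslateRecurrence` with the conditional refutation statement.

See `Negative-notes/chebotarev-curve-recurrence.md` (crux workfile) for the argument.
-/

set_option linter.dupNamespace false

namespace Summit.MatrixMultiplication.MatrixMultiplication.Cruxes.PairwiseCurvedTilingsLC.ChebotarevRecurrence

open Summit.MatrixMultiplication.MatrixMultiplication.Theses.DefinableSTPPDichotomy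

/-- **Isolating translates (combinatorial core, proved).** In any family satisfying the STPP
clause for the label patterns with at least two equal entries, for every block `i`, every point
`b - c` of its colour class `T_i = B_i − C_i` and all `a₀ ≠ a` in `A_i`, the translate
`(b - c) + a - a₀` lies in NO colour class `T_j = B_j − C_j` (neither `j ≠ i`: pattern `(i,j,i)`;
nor `j = i`: block TPP). -/
theorem isolating_translates {ι H : Type*} [AddCommGroup H] (I : Finset ι)
    (A B C : ι → Finset H)
    (hpair : ∀ i ∈ I, ∀ j ∈ I, ∀ k ∈ I, (i = j ∨ j = k ∨ k = i) →
      ∀ s ∈ A k, ∀ s' ∈ A i, ∀ t ∈ B i, ∀ t' ∈ B j, ∀ u ∈ C j, ∀ u' ∈ C k,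
        (s' - s) + (t' - t) + (u' - u) = 0 → i = j ∧ j = k ∧ s = s' ∧ t = t' ∧ u = u')
    {i : ι} (hi : i ∈ I) {b : H} (hb : b ∈ B i) {c : H} (hc : c ∈ C i)
    {a₀ a : H} (ha₀ : a₀ ∈ A i) (ha : a ∈ A i) (hne : a ≠ a₀)
    {j : ι} (hj : j ∈ I) {b' : H} (hb' : b' ∈ B j) {c' : H} (hc' : c' ∈ C j) :
    (b - c) + a - a₀ ≠ b' - c' := by
  intro h
  -- clause at `(i, j, k := i)` with `s := a ∈ A i`, `s' := a₀ ∈ A i`, `t := b`, `t' := b'`,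
  -- `u := c' ∈ C j`, `u' := c ∈ C i`
  have key := hpair i hi j hj i hi (Or.inr (Or.inr rfl)) a ha a₀ ha₀ b hb b' hb' c' hc' c hc ?_
  · exact hne key.2.2.1
  · have hb'' : b' = (b - c) + a - a₀ + c' := (sub_eq_iff_eq_add.1 h.symm)
    rw [hb'']
    abel

/-- The union `T = ⋃_{j ∈ I} (B_j − C_j)` of the colour classes misses every non-trivial
translate `t + a − a₀` (`t ∈ T_i`, `a₀ ≠ a ∈ A_i`): restatement of `isolating_translates` with
the classes as `Finset.image₂`. -/
theorem translate_not_mem_biUnion {ι H : Type*} [AddCommGroup H] [DecidableEq H]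
    (I : Finset ι) (A B C : ι → Finset H)
    (hpair : ∀ i ∈ I, ∀ j ∈ I, ∀ k ∈ I, (i = j ∨ j = k ∨ k = i) →
      ∀ s ∈ A k, ∀ s' ∈ A i, ∀ t ∈ B i, ∀ t' ∈ B j, ∀ u ∈ C j, ∀ u' ∈ C k,
        (s' - s) + (t' - t) + (u' - u) = 0 → i = j ∧ j = k ∧ s = s' ∧ t = t' ∧ u = u')
    {i : ι} (hi : i ∈ I) {b : H} (hb : b ∈ B i) {c : H} (hc : c ∈ C i)
    {a₀ a : H} (ha₀ : a₀ ∈ A i) (ha : a ∈ A i) (hne : a ≠ a₀) :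
    (b - c) + a - a₀ ∉ I.biUnion fun j => Finset.image₂ (· - ·) (B j) (C j) := by
  intro hmem
  obtain ⟨j, hj, hj'⟩ := Finset.mem_biUnion.1 hmem
  obtain ⟨b', hb', c', hc', heq⟩ := Finset.mem_image₂.1 hj'
  exact isolating_translates I A B C hpair hi hb hc ha₀ ha hne hj hb' hc' heq.symm

open scoped Classical in
/-- **Named fact (shape): recurrence of translates for definable sets over finite fields.**
For ring formulas `τ(w; ȳ)` (cutting out `T ⊆ F^m`) and `α(v; ȳ')` (cutting out `A ⊆ F^m`) of
fixed complexity there are `Q, K, C, c > 0` such that in every finite field `F` with `|F| ≥ Q`,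
for all parameters `ȳ` there is an exceptional set `E ⊆ F^m`, `|E| ≤ C |F|^{m−1}` (depending on
`τ, ȳ` ONLY), such that for all parameters `ȳ'`, whenever `|A| > K`, every non-exceptional point
`t ∈ T ∖ E` is translated into `T` by a positive proportion of the pairs `(a₀, a) ∈ A × A`:
`c |A|² ≤ #{(a₀,a) : t + a − a₀ ∈ T}`.
Derivation sketch (classical theorems, not in Mathlib): Kiefe's near model completeness
(every ring formula is, uniformly in finite fields, a Boolean combination of `∃u g(w̄,u)=0`)
[Kiefe1976; MacphersonSteinhorn2011 §4.2]; Lang–Weil / CDM for the top-dimensional component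
`𝒱` of `A` through a generic `a₀` [ChatzidakisVanDenDriesMacintyre1992]; and the uniform effective
Chebotarev density theorem for finite étale Galois covers of varieties over finite fields
[KatzSarnak1999 Thm 9.7.13; Lang 1956] applied on the translate `t − a₀ + 𝒱` to the joint cover
(splitting fields of the `g_j` for `τ` and for `α`): the simultaneous Frobenius class of the
unramified point `t` recurs at `≥ q^{dim 𝒱}/|G| − O(q^{dim 𝒱 − 1/2})` points, all in `T ∩ (t − a₀ + A)`.
[conjecture-shaped named fact; to be audited/vendored in Literature/ModelTheory/PseudofiniteFields] -/
def DefinableTranslateRecurrence : Prop :=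
  ∀ (m n n' : ℕ) (τ : FirstOrder.Language.ring.Formula (Fin m ⊕ Fin n))
    (α : FirstOrder.Language.ring.Formula (Fin m ⊕ Fin n')),
    ∃ (Q K : ℕ) (C c : ℝ), 0 < c ∧
      ∀ (F : Type) [Field F] [Fintype F] [FirstOrder.Ring.CompatibleRing F],
        Q ≤ Fintype.card F → ∀ (y : Fin n → F), ∃ E : Finset (Fin m → F),
          (E.card : ℝ) ≤ C * (Fintype.card F : ℝ) ^ ((m : ℝ) - 1) ∧
          ∀ (y' : Fin n' → F) (T A : Finset (Fin m → F)),
            (∀ w, w ∈ T ↔ τ.Realize (Sum.elim w y)) →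
            (∀ v, v ∈ A ↔ α.Realize (Sum.elim v y')) →
            K < A.card → ∀ t ∈ T, t ∉ E →
              c * (A.card : ℝ) ^ 2 ≤
                (((A ×ˢ A).filter fun p : (Fin m → F) × (Fin m → F) => t + p.2 - p.1 ∈ T).card : ℝ)

/-- **Conditional refutation of the crux (statement; proof = the negative note).**
`DefinableTranslateRecurrence → ¬ PairwiseCurvedTilingsLC`.  Sketch: take `ε := 1/(2m)` in the
crux; blocks whose three sets have size `≤ K` carry mass `≤ K^ε q^m` (Hölder + the three
packings + TPP weight bound); wlog the blocks with `|A_x| > K` carry mass `≥ q^{m+η}/4`, hence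
(Hölder again) `Σ_{|A_x|>K} |B_x||C_x| ≥ q^{m+3η−εm}/64 > C q^{m−1} ≥ |E|` for `q` large, where
`E` is the exceptional set of `T := ⋃_{x∈I}(B_x − C_x)` (definable: `τ := ∃x ∃b ∃c, φ_I ∧ φ_B ∧
φ_C ∧ w = b − c`); pick such a block `x` and `t = b − c ∈ T_x ∖ E`; recurrence gives
`≥ c|A_x|² > |A_x|` pairs `(a₀,a)` with `t + a − a₀ ∈ T`, so one with `a ≠ a₀` — contradicting
`translate_not_mem_biUnion`. No use of large characteristic, of `∀ ε`, or of CDM. -/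
def ConditionalRefutation : Prop :=
  DefinableTranslateRecurrence → ¬ PairwiseCurvedTilingsLC

/-- The same named fact proves the route's negative support item `DefinableDesignBarrier`
(stmt-MatrixMultiplication-18078) with `ε = 1/(2m)`, and refutes the target
`ExactDefinableDesign` (stmt-MatrixMultiplication-18073): statement shapes. -/
def ConditionalBarrier : Prop :=
  DefinableTranslateRecurrence → DefinableDesignBarrier

example : ConditionalRefutation = (DefinableTranslateRecurrence → ¬ PairwiseCurvedTilingsLC) := rfl

end Summit.MatrixMultiplication.MatrixMultiplication.Cruxes.PairwiseCurvedTilingsLC.ChebotarevRecurrence
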